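import Literature.MathematicalPhysics.QuantumFieldTheory.Balaban1983to89.Node00.Record12MinimiserSelection
import Literature.MathematicalPhysics.QuantumFieldTheory.Balaban1983to89.Node00.BackgroundActionOfRecord
import Literature.MathematicalPhysics.QuantumFieldTheory.Balaban1983to89.T4RootedResidualGauge

/-!
# NODE 00 — THE OFFER `UkSel`: the (0.21) minimiser of record READ IN THE ROOTED GAUGE through a MEASURABLE SELECTOR — same `IsBackground` ∕ junk
# contract as node00-def-B's `Uk`, same Wilson value, same minimal orbit; MEASURABLE ((H-U)); gauge-fixed, CANONICAL and (181)-COVARIANT on the [B11] domain ((M1′)ˢᵒˡ)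

Cell `pub-ymgap` (YM-PLAN Track A), seat `pub-ymgap-dag-n09-w4` (g2; D-0149 width seat of node N09), FILE 3; helper of K1⁷ `StabilityBAtRecordR13SepCoPH` =
stmt-QuantumFields-20542 (count-neutral).  [I] = [Balaban1987RG1] (CMP 109), [B11] = [Balaban1985Variational] (CMP 102), [III] = [Balaban1988Convergent] (CMP 119).
APPEND-ONLY growth: a NEW importing module over node00-def-B's `Node00/BackgroundActionOfRecord` (`Uk`, `UkExists`, `UniqueUkOrbit`, `bgReg`, `wilsonBGOfRecord`),
node00-def-K0c's `Node00/Record12MinimiserSelection` (`exists_measurable_isMinimizer_selector`), r08's `B15DeterminingSets` (`atScale`, `isMinimizer_atScale_iff`) and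
this seat's `T4RootedResidualGauge` (`rootGauge`) — cited BY NAME, nothing landed is edited, NO carrier of record re-pointed (node00-def-K0c's OFFER pattern,
`UminSelOfRecord`).

WHY.  N09's Theorem-3 member at the Stage-13 record (dag-n24-c junction `B12NodeKnitRecord13SepCoPH` v1.2; dag-n09-w2 ★ `…SepCoPHLoc`) displays TWO properties of
the selection `W ↦ U_{k+1}(W)` behind (2.3) ∕ (2.9) that print's axial-gauge minimiser has and the bare choice `Uk` lacks: (H-U) measurability and (M1′) block-lift
covariance — the latter REDUCED on the solvable set (dag-n09-w2) to [B11] (181) «U_k(V^v) = U_k(V)^{v̄}».  This file is the DROP-IN under which both are theorems: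
* §1 `exists_measurable_ukSelector K k ε` — a MEASURABLE selector of the (0.21) minimisers with `Uk`'s exact contract (K0c's (2.12) selector at the one-scale
  determining set `atScale k`, read through r08's bridge `isMinimizer_atScale_iff`; [B11] Thm 1 NOT used).  (Summits twin, proved directly from
  `exists_measurable_constrained_argmin`: `…/Theorems/BalabanUVNodesN09UkMeasurableSelector` §1.)
* §2 gauge transport of (0.21) (private twins of dag-n09-w2's `…N09LiftInvariance29AtRecord` §0, which lives in `Summits/`): solvability is gauge invariant, a
  minimiser over `V` is carried by `u` to a minimiser over `V^{u↾T⁽ᵏ⁾}`.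
* §3 ★ `rooted_selector`: for ANY selector `f₀` with the contract, `rootGauge k ∘ f₀` keeps it, is gauge-fixed, is CANONICAL on the [B11] domain (every minimiser
  over `V` — in particular `Uk … V` — has rooted gauge `= rootGauge k (f₀ V)` once `UniqueUkOrbit … V`), and is (181)-COVARIANT there.
* §4 ★★ THE OFFER `UkSel F N K k ε := rootGauge k ∘ (a fixed measurable selector)`: `isBackground_UkSel` ∕ `UkSel_of_not` (the two interface lemmas of `Uk`,
  verbatim), `measurable_UkSel` ((H-U) as a theorem), `measurable_iter_UkSel` (every `W ↦ M^j(UkSel W)` — the (2.3) shape — measurable), `wilsonAction4_UkSel`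
  (`A(UkSel V) = A(Uk V)` everywhere: `wilsonBGOfRecord` is unchanged by the re-point), `orbitRel_Uk_UkSel` (same minimal orbit under `UniqueUkOrbit`),
  `rootGauge_UkSel` (gauge-fixed), `rootGauge_eq_UkSel_of_isBackground` ∕ `rootGauge_Uk_eq_UkSel` (canonical), ★ `UkSel_gaugeAct_blockLift` ((181): `UkSel (V^v) =
  (UkSel V)^{blockLift k v}` whenever `UkExists … V ∧ UniqueUkOrbit … (V^v)`), ★ `iter_UkSel_gaugeAct_liftTransf` (the (2.3)-shaped critical configuration
  `M^k(UkSel_{k+1} W)` is block-lift covariant on that domain — the junction's (M1′) binder `hcov` with `Uk ↦ UkSel`, ON THE [B11] DOMAIN).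

LOCATED READING.  Adopting `UkSel` in `critCfgOfRecord` ∕ `chiFix29OfRecord` ∕ the β-layer is a RECORD EDITION (node00-def-B ∕ K0e ∕ def-T's call) and is NOT done here;
this file only prices it: (H-U) becomes `measurable_UkSel`, (M1′) becomes `iter_UkSel_gaugeAct_liftTransf` on `{UkExists ∧ UniqueUkOrbit}` (where the junction's `h11`
puts the flow); off the solvable set every junk-default-`1` selector violates block-lift covariance (dag-n09-w2's junk-corner obstruction), so (M1′) for ALL `W` is
available to NO re-point — the on-domain re-typing is dag-n09-w2's p591459.  The rooted gauge is a coordinate-comb variant of print's hierarchical axial gauge (same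
residual group, same transformation laws).

HONEST FRAMING — what this is NOT.  Kernel bookkeeping (a selection theorem already in the tree, telescoping gauge algebra, mutual minimality); NOTHING of Bałaban's
asserted ([B11] Thm 1 enters only as the hypotheses `UkExists` ∕ `UniqueUkOrbit`); no estimate; NO carrier of record re-pointed; NOT a discharge of any node; K0⁷ ∕ K1⁷
NOT closed; counts unmoved (typed 28∕28 · discharged 5∕27); one finite four-torus programme at fixed `ε = L^{−K}` — R4 is the conditional rung `BalabanLadder.UV` only;
NOT continuum ∕ ℝ⁴ ∕ OS; the YM mass gap (Clay) is NOT proved by any of this.  ONE `def` (`UkSel`) + theorems; 0 `sorry`, 0 `instance`, 0 `notation`.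
-/

noncomputable section

open MeasureTheory Set

namespace Literature.MathematicalPhysics.QuantumFieldTheory.Balaban1983to89.Node00

open T4Continuum (T4Family)
open B12GaugeOrbits021 (OrbitRel IsResidual isBackground_gaugeAct plaqSmall_gaugeAct_iff')
open B15DeterminingSets (atScale isMinimizer_atScale_iff MSField IsMinimizer)
open B15Eq177GaugeInvariance (blockLift blockLift_succ toMS_blockLift_self)
open B16Sect1Backgrounds (toMS iter_gaugeAct)
open B12RTGaugeInvariance254 (liftTransf invTransf gaugeAct_inv_gaugeAct)
open T4RootedResidualGauge (rootGauge rootGauge_one rootGauge_rootGauge rootGauge_eq_of_orbitRel rootGauge_gaugeAct_blockLift isResidual_rootTransporter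
  measurable_rootGauge)
open GaugeField (gaugeAct)

variable {F : T4Family} {N : ℕ} [NeZero N]

/-! ## §1  A measurable selector of the (0.21) minimisers of record (K0c's theorem at the one-scale determining set) -/

/-- **A MEASURABLE SELECTOR OF THE (0.21) MINIMISERS**, with node00-def-B's exact contract: `IsBackground … V (f V)` on the solvable set (`UkExists`), `f V = 1` off it.
The (0.21) problem at level `k` IS the (2.12) problem at r08's one-scale determining set `atScale k` (`isMinimizer_atScale_iff`), so node00-def-K0c's
`exists_measurable_isMinimizer_selector` — precomposed with the measurable embedding `V ↦ (V at scale k, 1 elsewhere)` — is such a selector.  [B11] Thm 1 NOT used.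
[cite: Balaban1987RG1, (0.21) p.256; Balaban1988Convergent, (2.12) p.256] -/
theorem exists_measurable_ukSelector (K k : ℕ) (ε : ℝ) :
    ∃ f : GaugeField (F.P K) k (SU N) → GaugeField (F.P K) 0 (SU N), Measurable f ∧
      (∀ V, UkExists F N K k ε V → IsBackground (avOfRecord F N K) (bgReg F N K k ε) k V (f V)) ∧
      (∀ V, ¬ UkExists F N K k ε V → f V = 1) := by
  classical
  have h𝔹 : ∀ j, k < j → (atScale k : B15DeterminingSets.DetSet (F.P K)) j = ∅ := fun j hj => by
    simp [atScale, Nat.ne_of_gt hj]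
  obtain ⟨g, hgm, hgin, hgout⟩ := exists_measurable_isMinimizer_selector F N K (ε * (F.P K).eta k ^ 2) (atScale k) k h𝔹
  -- the embedding of a scale-`k` field as a multi-scale datum (junk `1` at the other scales)
  let ι : GaugeField (F.P K) k (SU N) → MSField (F.P K) (SU N) :=
    Function.update (fun j => (1 : GaugeField (F.P K) j (SU N))) k
  have hιk : ∀ V, ι V k = V := fun V => by
    show Function.update (fun j => (1 : GaugeField (F.P K) j (SU N))) k V k = V
    exact Function.update_self (β := fun j => GaugeField (F.P K) j (SU N)) k V _
  have hι : Measurable ι := measurable_update _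
  have hbr : ∀ V U₀, IsMinimizer (avOfRecord F N K) {U | PlaqSmall (ε * (F.P K).eta k ^ 2) U} (atScale k) (ι V) U₀ ↔
      IsBackground (avOfRecord F N K) (bgReg F N K k ε) k V U₀ := fun V U₀ => by
    rw [isMinimizer_atScale_iff, hιk]; rfl
  refine ⟨fun V => g (ι V), hgm.comp hι, fun V hV => ?_, fun V hV => ?_⟩
  · obtain ⟨U₀, hU₀⟩ := hV
    exact (hbr V _).1 (hgin (ι V) ⟨U₀, (hbr V U₀).2 hU₀⟩)
  · exact hgout (ι V) fun ⟨U₀, hU₀⟩ => hV ⟨U₀, (hbr V U₀).1 hU₀⟩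

/-! ## §2  Gauge transport of the (0.21) problem of record (private twins of dag-n09-w2's `Summits/…/BalabanUVNodesN09LiftInvariance29AtRecord` §0) -/

section Transport

variable {K k : ℕ} {ε : ℝ}

/-- The plaquette class `bgReg` is stable under every gauge transformation (`dist1` is conjugation invariant). [cite: Balaban1987RG1, (1.2) p.260 (bookkeeping)] -/
theorem gaugeAct_mem_bgReg' (u : GaugeTransf (F.P K) 0 (SU N)) (U : GaugeField (F.P K) 0 (SU N)) (hU : U ∈ bgReg F N K k ε) :
    gaugeAct u U ∈ bgReg F N K k ε :=
  (mem_bgReg_iff F N K k ε _).2 ((plaqSmall_gaugeAct_iff' _ u U).2 ((mem_bgReg_iff F N K k ε U).1 hU))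

/-- A minimiser `U₀` over `W` is carried by any fine gauge transformation `u` to a minimiser `U₀^u` over `W^{u↾T⁽ᵏ⁾}` (dag-n09-w2's `isBackground_gaugeAct_toMS`,
Literature twin; standing range `k ≤ m + K`). [cite: Balaban1987RG1, (0.21) p.256; Balaban1985Variational, (181) p.307] -/
theorem isBackground_gaugeAct_toMS' (hk : k ≤ (F.P K).m + (F.P K).K) {W : GaugeField (F.P K) k (SU N)} {U₀ : GaugeField (F.P K) 0 (SU N)}
    (h : IsBackground (avOfRecord F N K) (bgReg F N K k ε) k W U₀) (u : GaugeTransf (F.P K) 0 (SU N)) :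
    IsBackground (avOfRecord F N K) (bgReg F N K k ε) k (gaugeAct (toMS u k) W) (gaugeAct u U₀) := by
  refine ⟨?_, gaugeAct_mem_bgReg' u U₀ h.2.1, fun U hU hUW => ?_⟩
  · rw [iter_gaugeAct (avOfRecord F N K) u U₀ k hk, h.1]
  · have hU' : gaugeAct (invTransf u) U ∈ bgReg F N K k ε := gaugeAct_mem_bgReg' (invTransf u) U hU
    have hUW' : Averaging.iter (avOfRecord F N K) k (gaugeAct (invTransf u) U) = W := by
      rw [iter_gaugeAct (avOfRecord F N K) (invTransf u) U k hk, hUW]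
      exact gaugeAct_inv_gaugeAct (toMS u k) W
    have hmin := h.2.2 (gaugeAct (invTransf u) U) hU' hUW'
    rw [B14Eq16FaddeevPopov.wilsonAction4_gaugeAct'] at hmin
    rw [B14Eq16FaddeevPopov.wilsonAction4_gaugeAct']
    exact hmin

/-- Solvability of (0.21) is gauge invariant (dag-n09-w2's `ukExists_gaugeAct_iff`, Literature twin). [cite: Balaban1987RG1, (0.21) p.256 (bookkeeping)] -/
theorem ukExists_gaugeAct_iff' (hk : k ≤ (F.P K).m + (F.P K).K) (v : GaugeTransf (F.P K) k (SU N)) (W : GaugeField (F.P K) k (SU N)) :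
    UkExists F N K k ε (gaugeAct v W) ↔ UkExists F N K k ε W := by
  have key : ∀ (v : GaugeTransf (F.P K) k (SU N)) (W : GaugeField (F.P K) k (SU N)), UkExists F N K k ε W → UkExists F N K k ε (gaugeAct v W) := by
    intro v W ⟨U₀, hU₀⟩
    refine ⟨gaugeAct (blockLift k v) U₀, ?_⟩
    have h := isBackground_gaugeAct_toMS' (ε := ε) hk hU₀ (blockLift k v)
    rwa [toMS_blockLift_self hk] at h
  refine ⟨fun h => ?_, key v W⟩
  have h' := key (invTransf v) _ h
  rwa [gaugeAct_inv_gaugeAct] at h'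

/-- `(blockLift (k+1) v)↾T⁽ᵏ⁾ = v ∘ blockOf` (dag-n09-w2's `toMS_blockLift_succ`, twin). [cite: Balaban1985Variational, (181) p.307 (bookkeeping)] -/
theorem toMS_blockLift_succ' {P : Params} {G : Type*} {k : ℕ} (hk : k ≤ P.m + P.K) (v : GaugeTransf P (k + 1) G) :
    toMS (blockLift (k + 1) v) k = liftTransf v := by
  rw [blockLift_succ]
  exact toMS_blockLift_self hk _

end Transport

/-! ## §3  ★ The rooted selector (any selector with the contract, read in the rooted gauge) -/

section Rooted

variable {K k : ℕ} {ε : ℝ}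

/-- `bgReg` is stable under the residual gauge group. [cite: Balaban1987RG1, (1.2) p.260 (bookkeeping)] -/
theorem bgReg_residual_stable : ∀ u : GaugeTransf (F.P K) 0 (SU N), IsResidual k u → ∀ U ∈ bgReg F N K k ε, gaugeAct u U ∈ bgReg F N K k ε :=
  fun u _ U hU => gaugeAct_mem_bgReg' u U hU

/-- A minimiser over `V` stays a minimiser over `V` in its rooted gauge (residual invariance of (0.21), dag-p07 `isBackground_gaugeAct`). [cite: Balaban1987RG1, (0.21) p.256] -/
theorem isBackground_rootGauge (hk : k ≤ (F.P K).m + (F.P K).K) {V : GaugeField (F.P K) k (SU N)} {U₀ : GaugeField (F.P K) 0 (SU N)}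
    (h : IsBackground (avOfRecord F N K) (bgReg F N K k ε) k V U₀) : IsBackground (avOfRecord F N K) (bgReg F N K k ε) k V (rootGauge k U₀) :=
  isBackground_gaugeAct hk bgReg_residual_stable h (isResidual_rootTransporter hk U₀)

/-- **CANONICITY ON THE [B11] DOMAIN**: under `UniqueUkOrbit … V` ([B11] Thm 1 — DISPLAYED) ALL minimisers over `V` have ONE rooted gauge. [cite: Balaban1985Variational, Thm 1 p.279] -/
theorem rootGauge_eq_of_isBackground_of_unique {V : GaugeField (F.P K) k (SU N)} (hu : UniqueUkOrbit F N K k ε V)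
    {U₀ U₁ : GaugeField (F.P K) 0 (SU N)} (h₀ : IsBackground (avOfRecord F N K) (bgReg F N K k ε) k V U₀)
    (h₁ : IsBackground (avOfRecord F N K) (bgReg F N K k ε) k V U₁) : rootGauge k U₀ = rootGauge k U₁ :=
  (rootGauge_eq_of_orbitRel (hu U₀ U₁ h₀ h₁)).symm

/-- **★ THE ROOTED SELECTOR.**  For ANY selector `f₀` of the (0.21) minimisers with the contract (minimiser on the solvable set, `1` off it), `rootGauge k ∘ f₀`
(i) keeps the contract, (ii) is gauge-fixed, (iii) is CANONICAL on the [B11] domain — every minimiser over `V`, in particular the bare choice `Uk … V`, has rooted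
gauge `rootGauge k (f₀ V)` — and (iv) is (181)-COVARIANT there: `rootGauge k (f₀ (V^v)) = (rootGauge k (f₀ V))^{blockLift k v}` whenever (0.21) is solvable at `V` and the
minimal orbit over `V^v` is unique; (v) measurable when `f₀` is.  Standing range `k ≤ m + K`. [cite: Balaban1985Variational, (181) p.307 and Thm 1 p.279; Balaban1987RG1, (0.21) p.256] -/
theorem rooted_selector (hk : k ≤ (F.P K).m + (F.P K).K) {f₀ : GaugeField (F.P K) k (SU N) → GaugeField (F.P K) 0 (SU N)}
    (hsel : ∀ V, UkExists F N K k ε V → IsBackground (avOfRecord F N K) (bgReg F N K k ε) k V (f₀ V))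
    (hout : ∀ V, ¬ UkExists F N K k ε V → f₀ V = 1) :
    (∀ V, UkExists F N K k ε V → IsBackground (avOfRecord F N K) (bgReg F N K k ε) k V (rootGauge k (f₀ V))) ∧
    (∀ V, ¬ UkExists F N K k ε V → rootGauge k (f₀ V) = 1) ∧
    (∀ V, rootGauge k (rootGauge k (f₀ V)) = rootGauge k (f₀ V)) ∧
    (∀ V U₀, UniqueUkOrbit F N K k ε V → IsBackground (avOfRecord F N K) (bgReg F N K k ε) k V U₀ → rootGauge k U₀ = rootGauge k (f₀ V)) ∧
    (∀ V, UkExists F N K k ε V → UniqueUkOrbit F N K k ε V → rootGauge k (Uk F N K k ε V) = rootGauge k (f₀ V)) ∧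
    (∀ (v : GaugeTransf (F.P K) k (SU N)) V, UkExists F N K k ε V → UniqueUkOrbit F N K k ε (gaugeAct v V) →
      rootGauge k (f₀ (gaugeAct v V)) = gaugeAct (blockLift k v) (rootGauge k (f₀ V))) ∧
    (Measurable f₀ → Measurable fun V => rootGauge k (f₀ V)) := by
  refine ⟨fun V h => isBackground_rootGauge hk (hsel V h), fun V h => by rw [hout V h, rootGauge_one], fun V => rootGauge_rootGauge hk _,
    fun V U₀ hu h₀ => ?_, fun V h hu => ?_, fun v V h hu => ?_, fun hf => (measurable_rootGauge k).comp hf⟩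
  · have hV : UkExists F N K k ε V := ⟨U₀, h₀⟩
    exact rootGauge_eq_of_isBackground_of_unique hu h₀ (hsel V hV)
  · exact rootGauge_eq_of_isBackground_of_unique hu (isBackground_Uk h) (hsel V h)
  · have hW : UkExists F N K k ε (gaugeAct v V) := (ukExists_gaugeAct_iff' hk v V).2 h
    have h₂ : IsBackground (avOfRecord F N K) (bgReg F N K k ε) k (gaugeAct v V) (gaugeAct (blockLift k v) (rootGauge k (f₀ V))) := by
      have := isBackground_gaugeAct_toMS' hk (isBackground_rootGauge hk (hsel V h)) (blockLift k v)
      rwa [toMS_blockLift_self hk] at this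
    rw [← rootGauge_eq_of_isBackground_of_unique hu h₂ (hsel _ hW), rootGauge_gaugeAct_blockLift hk, rootGauge_rootGauge hk]

end Rooted

/-! ## §4  ★★ THE OFFER `UkSel` — `U_k` of record read in the rooted gauge through a measurable selector -/

section Offer

variable (F N)

/-- **`U_k(V)` IN THE ROOTED GAUGE THROUGH A MEASURABLE SELECTOR** (offered drop-in for node00-def-B's `Uk`; NOT a re-point): a fixed measurable selector of the
(0.21) minimisers (§1, one global choice of a FUNCTION), followed by the rooted residual gauge fixing of level `k`.  Same TYPE and same values-level contract as `Uk`.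
[cite: Balaban1987RG1, (0.21) p.256 and (2.3) p.265; Balaban1985Variational, (181) p.307] -/
def UkSel (K k : ℕ) (ε : ℝ) (V : GaugeField (F.P K) k (SU N)) : GaugeField (F.P K) 0 (SU N) :=
  rootGauge k (Classical.choose (exists_measurable_ukSelector (F := F) (N := N) K k ε) V)

variable {F N} {K k : ℕ} {ε : ℝ}

/-- The underlying selector's contract (unpacking of §1's choice). [cite: Balaban1987RG1, (0.21) p.256 (bookkeeping)] -/
private theorem sel_spec (K k : ℕ) (ε : ℝ) :
    Measurable (Classical.choose (exists_measurable_ukSelector (F := F) (N := N) K k ε)) ∧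
      (∀ V, UkExists F N K k ε V → IsBackground (avOfRecord F N K) (bgReg F N K k ε) k V
        (Classical.choose (exists_measurable_ukSelector (F := F) (N := N) K k ε) V)) ∧
      (∀ V, ¬ UkExists F N K k ε V → Classical.choose (exists_measurable_ukSelector (F := F) (N := N) K k ε) V = 1) :=
  Classical.choose_spec (exists_measurable_ukSelector (F := F) (N := N) K k ε)

/-- **THE CHARACTERISING PROPERTY** (= `isBackground_Uk` for the offer): on the solvable set `UkSel … V` IS a (0.21) minimiser over `V` (standing range).
[cite: Balaban1985Variational, Thm 1 p.279] -/
theorem isBackground_UkSel (hk : k ≤ (F.P K).m + (F.P K).K) {V : GaugeField (F.P K) k (SU N)} (h : UkExists F N K k ε V) :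
    IsBackground (avOfRecord F N K) (bgReg F N K k ε) k V (UkSel F N K k ε V) :=
  (rooted_selector hk (sel_spec K k ε).2.1 (sel_spec K k ε).2.2).1 V h

/-- Off the solvable set `UkSel … V = 1` (= `Uk_of_not` for the offer). [cite: Balaban1987RG1, (0.21) p.256 (typing convention)] -/
theorem UkSel_of_not {V : GaugeField (F.P K) k (SU N)} (h : ¬ UkExists F N K k ε V) : UkSel F N K k ε V = 1 := by
  unfold UkSel
  rw [(sel_spec K k ε).2.2 V h, rootGauge_one]

/-- Off the solvable set the offer and the bare choice coincide. [cite: Balaban1987RG1, (0.21) p.256 (typing convention)] -/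
theorem UkSel_eq_Uk_of_not {V : GaugeField (F.P K) k (SU N)} (h : ¬ UkExists F N K k ε V) : UkSel F N K k ε V = Uk F N K k ε V := by
  rw [UkSel_of_not h, Uk_of_not h]

/-- **(H-U) AS A THEOREM for the offer**: `V ↦ UkSel … V` is MEASURABLE. [cite: Balaban1987RG1, (0.21) p.256 and (2.3) p.265] -/
theorem measurable_UkSel (K k : ℕ) (ε : ℝ) : Measurable (UkSel F N K k ε) :=
  (measurable_rootGauge k).comp (sel_spec (F := F) (N := N) K k ε).1

/-- Every averaged image `W ↦ M^j(UkSel … W)` — the (2.3) shape of the critical configuration — is measurable (K0e's `measurable_critCfgOfRecord_of` with its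
hypothesis discharged for the offer). [cite: Balaban1987RG1, (2.3) p.265] -/
theorem measurable_iter_UkSel (K k : ℕ) (ε : ℝ) (j : ℕ) : Measurable fun W => Averaging.iter (avOfRecord F N K) j (UkSel F N K k ε W) := by
  have hiter : ∀ j : ℕ, Measurable (Averaging.iter (avOfRecord F N K) j) := by
    intro j
    induction j with
    | zero => exact measurable_id
    | succ j ih => exact (avOfRecord_measurable F N K j).comp ih
  exact (hiter j).comp (measurable_UkSel (F := F) (N := N) K k ε)

/-- **SAME WILSON VALUE EVERYWHERE**: `A(UkSel V) = A(Uk V)` — so `wilsonBGOfRecord` (and everything reading `U_k` through `A^η(U_k)`) is UNCHANGED by the re-point.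
[cite: Balaban1987RG1, (0.21)-(0.22) p.256] -/
theorem wilsonAction4_UkSel (hk : k ≤ (F.P K).m + (F.P K).K) (V : GaugeField (F.P K) k (SU N)) :
    wilsonAction4 (UkSel F N K k ε V) = wilsonAction4 (Uk F N K k ε V) := by
  by_cases h : UkExists F N K k ε V
  · exact wilsonAction4_eq_of_isBackground (isBackground_UkSel hk h)
  · rw [UkSel_eq_Uk_of_not h]

/-- **SAME MINIMAL ORBIT** under [B11] Thm 1's uniqueness clause (DISPLAYED). [cite: Balaban1985Variational, Thm 1 p.279] -/
theorem orbitRel_Uk_UkSel (hk : k ≤ (F.P K).m + (F.P K).K) {V : GaugeField (F.P K) k (SU N)} (h : UkExists F N K k ε V) (hu : UniqueUkOrbit F N K k ε V) :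
    OrbitRel k (Uk F N K k ε V) (UkSel F N K k ε V) :=
  hu _ _ (isBackground_Uk h) (isBackground_UkSel hk h)

/-- The offer is GAUGE-FIXED: `rootGauge k (UkSel V) = UkSel V`. [cite: Balaban1985Variational, (19) p.281 (bookkeeping)] -/
theorem rootGauge_UkSel (hk : k ≤ (F.P K).m + (F.P K).K) (V : GaugeField (F.P K) k (SU N)) : rootGauge k (UkSel F N K k ε V) = UkSel F N K k ε V :=
  (rooted_selector hk (sel_spec K k ε).2.1 (sel_spec K k ε).2.2).2.2.1 V

/-- **CANONICITY**: under `UniqueUkOrbit … V` EVERY minimiser `U₀` over `V` has rooted gauge `UkSel … V` — the offer does not depend on the selector behind it.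
[cite: Balaban1985Variational, Thm 1 p.279 and (181) p.307] -/
theorem rootGauge_eq_UkSel_of_isBackground (hk : k ≤ (F.P K).m + (F.P K).K) {V : GaugeField (F.P K) k (SU N)} (hu : UniqueUkOrbit F N K k ε V)
    {U₀ : GaugeField (F.P K) 0 (SU N)} (h₀ : IsBackground (avOfRecord F N K) (bgReg F N K k ε) k V U₀) : rootGauge k U₀ = UkSel F N K k ε V :=
  (rooted_selector hk (sel_spec K k ε).2.1 (sel_spec K k ε).2.2).2.2.2.1 V U₀ hu h₀

/-- In particular the bare choice `Uk … V`, read in the rooted gauge, IS the offer (on the [B11] domain). [cite: Balaban1985Variational, Thm 1 p.279] -/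
theorem rootGauge_Uk_eq_UkSel (hk : k ≤ (F.P K).m + (F.P K).K) {V : GaugeField (F.P K) k (SU N)} (h : UkExists F N K k ε V)
    (hu : UniqueUkOrbit F N K k ε V) : rootGauge k (Uk F N K k ε V) = UkSel F N K k ε V :=
  (rooted_selector hk (sel_spec K k ε).2.1 (sel_spec K k ε).2.2).2.2.2.2.1 V h hu

/-- **★ [B11] (181) AS A THEOREM for the offer, ON THE [B11] DOMAIN**: `UkSel (V^v) = (UkSel V)^{v̄}`, `v̄ = blockLift k v`, whenever (0.21) is solvable at `V` and
the minimal orbit over `V^v` is unique. [cite: Balaban1985Variational, (181) p.307] -/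
theorem UkSel_gaugeAct_blockLift (hk : k ≤ (F.P K).m + (F.P K).K) (v : GaugeTransf (F.P K) k (SU N)) {V : GaugeField (F.P K) k (SU N)}
    (h : UkExists F N K k ε V) (hu : UniqueUkOrbit F N K k ε (gaugeAct v V)) :
    UkSel F N K k ε (gaugeAct v V) = gaugeAct (blockLift k v) (UkSel F N K k ε V) :=
  (rooted_selector hk (sel_spec K k ε).2.1 (sel_spec K k ε).2.2).2.2.2.2.2.1 v V h hu

/-- **★ (M1′) AS A THEOREM for the offer, ON THE [B11] DOMAIN**: the (2.3)-shaped critical configuration `M^k(UkSel_{k+1} W)` is block-lift covariant —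
`M^k(UkSel (W^v)) = (M^k(UkSel W))^{v∘blockOf}` — for `W` solvable with unique minimal orbit over `W^v` (the junction's binder `hcov` with `Uk ↦ UkSel`;
`M^k(U^u) = (M^k U)^{u↾T⁽ᵏ⁾}`, r13 `iter_gaugeAct`). [cite: Balaban1987RG1, (2.3) p.265; Balaban1985Variational, (181) p.307] -/
theorem iter_UkSel_gaugeAct_liftTransf {k : ℕ} (hk : k + 1 ≤ (F.P K).m + (F.P K).K) (v : GaugeTransf (F.P K) (k + 1) (SU N))
    {W : GaugeField (F.P K) (k + 1) (SU N)} (hW : UkExists F N K (k + 1) ε W) (hu : UniqueUkOrbit F N K (k + 1) ε (gaugeAct v W)) :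
    Averaging.iter (avOfRecord F N K) k (UkSel F N K (k + 1) ε (gaugeAct v W)) =
      gaugeAct (liftTransf v) (Averaging.iter (avOfRecord F N K) k (UkSel F N K (k + 1) ε W)) := by
  rw [UkSel_gaugeAct_blockLift hk v hW hu, iter_gaugeAct (avOfRecord F N K) _ _ k (Nat.le_of_succ_le hk), toMS_blockLift_succ' (Nat.le_of_succ_le hk)]

end Offer

/-! ## §5  Non-vacuity at the degenerate level `k = 0` (A6 hygiene): there the constraint is `U = V`, every hypothesis above is inhabited and `UkSel` is the identity on `bgReg`
(node00-def-B's `ukExists_zero_iff` ∕ `Uk_zero` are the `Uk`-side twins) -/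

section LevelZero

variable {K : ℕ} {ε : ℝ}

/-- At level `0` the minimal orbit is trivially unique (both minimisers equal `V`). [cite: Balaban1985Variational, Thm 1 p.279 (bookkeeping)] -/
theorem uniqueUkOrbit_zero (V : GaugeField (F.P K) 0 (SU N)) : UniqueUkOrbit F N K 0 ε V := by
  intro U₀ U₁ h₀ h₁
  have e₀ : U₀ = V := h₀.1
  have e₁ : U₁ = V := h₁.1
  rw [e₀, e₁]
  exact OrbitRel.refl 0 V

/-- At level `0` the rooted gauge is the identity (every site is its own root). [cite: Balaban1985Variational, (19) p.281 (bookkeeping)] -/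
theorem rootGauge_zero (U : GaugeField (F.P K) 0 (SU N)) : rootGauge 0 U = U := by
  have h : T4RootedResidualGauge.rootTransporter 0 U = fun _ => 1 := by
    funext x
    exact T4RootedResidualGauge.pathHol_self U x _
  unfold rootGauge
  rw [h]
  exact B12RTGaugeInvariance254.gaugeAct_one' U

/-- So at level `0` the offer is the identity on the regular class: `UkSel … 0 ε V = V` for `V ∈ bgReg` — and §4's hypotheses `UkExists` ∕ `UniqueUkOrbit` are
inhabited there (by every regular `V`, e.g. `V = 1` for `0 < ε`), so §3–§4 are not vacuous schemas. [cite: Balaban1987RG1, (0.21) p.256 (bookkeeping)] -/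
theorem UkSel_zero_of_mem {V : GaugeField (F.P K) 0 (SU N)} (hV : V ∈ bgReg F N K 0 ε) : UkSel F N K 0 ε V = V := by
  have h := (isBackground_UkSel (F := F) (N := N) (ε := ε) (k := 0) (Nat.zero_le _) (ukExists_zero_iff.2 hV)).1
  exact h

/-- The unit configuration is regular at every level and radius `0 < ε` (`|1 − 1| = 0`), so `UkExists F N K 0 ε 1`. [cite: Balaban1987RG1, (1.2) p.260 (bookkeeping)] -/
theorem one_mem_bgReg (K k : ℕ) (hε : 0 < ε) : (1 : GaugeField (F.P K) 0 (SU N)) ∈ bgReg F N K k ε := by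
  rw [mem_bgReg_iff]
  intro p
  have h1 : GaugeField.plaqHol (1 : GaugeField (F.P K) 0 (SU N)) p = 1 := by
    simp only [GaugeField.plaqHol]
    show (1 : SU N) * 1 * 1⁻¹ * 1⁻¹ = 1
    group
  rw [h1, GaugeGroup.dist1_one]
  have hη : 0 < (F.P K).eta k := by
    unfold Params.eta
    exact pow_pos (inv_pos.mpr (Nat.cast_pos.mpr (F.P K).L_pos)) k
  exact mul_pos hε (pow_pos hη 2)

/-- Hence the level-`0` instance of every clause of §4 at `V = 1`, `0 < ε`: solvable, unique, and `UkSel … 0 ε 1 = 1`. [cite: Balaban1987RG1, (0.21) p.256 (bookkeeping)] -/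
theorem ukSel_levelZero_witness (K : ℕ) (hε : 0 < ε) :
    UkExists F N K 0 ε (1 : GaugeField (F.P K) 0 (SU N)) ∧ UniqueUkOrbit F N K 0 ε (1 : GaugeField (F.P K) 0 (SU N)) ∧
      UkSel F N K 0 ε (1 : GaugeField (F.P K) 0 (SU N)) = 1 :=
  ⟨ukExists_zero_iff.2 (one_mem_bgReg K 0 hε), uniqueUkOrbit_zero _, UkSel_zero_of_mem (one_mem_bgReg K 0 hε)⟩

end LevelZero

end Literature.MathematicalPhysics.QuantumFieldTheory.Balaban1983to89.Node00

end
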